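import Literature.AlgebraicGeometry.Frobenioids.BirationalNormalizationExampleIsFrobenioid
import Literature.AlgebraicGeometry.Frobenioids.BiratLocalization
import Literature.AlgebraicGeometry.Frobenioids.BirationalizationFunctor
import HarnessLib

/-!
# Frobenioids I, Example 4.6: "`O^×(A^birat) = M₀`" — the units of the birationalization

Mochizuki, *The geometry of Frobenioids I: the general theory*, Kyushu J. Math. **62** (2008)
293–400, kurims text p. 87 [cite: MochizukiFrdI2008, Ex. 4.6 p.87]: "one computes easily that for
`A^birat ∈ Ob(C^birat)`, `O^×(A^birat) = M₀`, where we write `M₀ ⊆ M` for the subgroup of `(g, a, b) ∈ M` such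
that `a + b = 0`." PROOF-ONLY; sequel of `BirationalNormalizationExampleIsFrobenioid.lean` (seat
abc-iut-L1-t8), over seat abc-iut-L6-t8's birationalization (`PreFrobenioid.Birat`, `Birat.homMk`,
`Birat.toElemGp`; [FrdI] Prop. 4.4 (i)). No new definitions: the **value** of a birational fraction
`(α : E → A, φ : E → A)` is the element `μ(φ) − α_{d(φ)}(μ(α)) ∈ M` (written out in each statement).

PROVED: the value is constant on the classes of `Hom^birat(A, A)` (`value_eq_of_rel`) and turns composition
into `(m, m') ↦ m' + α_{d'}(m)` (`value_compWith`); an element of `O^▷(A^birat)` is the class of a pair of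
pre-steps and its value lies in `M₀` (`mem_M₀_of_mem_endSubmonoid`); two such classes with the same value are
equal (`homMk_eq_homMk_of_value_eq`); every `m ∈ M₀` is the value of such a class (`exists_homMk_value_eq`);
whence **`exists_endEquivM₀`: `O^▷(A^birat) (= O^×(A^birat)) ≃ M₀`**, multiplicative, given by the value; and
"the morphisms `(0, 0, 0, d)` determine … an action of `N_{≥1}` on `O^×(A₀^birat) = M₀`, which … coincide[s]
with the restriction to `M₀` of the original action" (`frobenius_transport_value`: `u ≫ ζ_d = ζ_d ≫ u'` with
`value(u') = α_d(value(u))`, via injectivity in every degree `homMk_eq_homMk_of_value_eq'`).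
No statement of the paper is strengthened; nothing here takes a side on [IUTchIII] Cor. 3.12.
-/

namespace Literature.AlgebraicGeometry.Frobenioids

open CategoryTheory Opposite

namespace Ex46

open PreFrobenioid

variable {G : Type} [AddCommGroup G] (P : Datum G)

/-! ### The value of a birational fraction and its invariance -/

/-- `μ` of a composite with a degree-one second factor: `μ(f ≫ f') = μ(f') + μ(f)`. [cite: MochizukiFrdI2008, Ex. 4.6 p.87] -/
theorem μ_comp_of_d_eq_one {A B C' : Obj P} (f : A ⟶ B) (f' : B ⟶ C') (h : (val P f').d = 1) :
    (val P (f ≫ f')).μ = (val P f').μ + (val P f).μ := by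
  rw [val_comp, N.mul_μ, h, Datum.α_one, AddMonoidHom.id_apply]

/-- `μ` of a general composite: `μ(f ≫ f') = μ(f') + α_{d(f')}(μ(f))`. [cite: MochizukiFrdI2008, Ex. 4.6 p.87] -/
theorem μ_comp {A B C' : Obj P} (f : A ⟶ B) (f' : B ⟶ C') :
    (val P (f ≫ f')).μ = (val P f').μ + P.α (val P f').d (val P f).μ := by
  rw [val_comp, N.mul_μ]

/-- **Invariance**: related fractions `(α, φ) ∼ (α', φ')` (common co-angular pre-step refinement) have the same
value `μ(φ) − α_{d}(μ(α))`. [cite: MochizukiFrdI2008, Ex. 4.6 p.87] -/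
theorem value_eq_of_rel {A : Obj P} {f g : BiratFrac (toElem P) A A} (h : BiratFrac.Rel f g) :
    (val P f.num).μ - P.α (val P f.num).d (val P f.den).μ = (val P g.num).μ - P.α (val P g.num).d (val P g.den).μ := by
  obtain ⟨E, ε, ε', hε, hε', hd, hn⟩ := h
  have hε1 : (val P ε).d = 1 := (isCoAngularPreStep_iff P ε).mp hε
  have hε1' : (val P ε').d = 1 := (isCoAngularPreStep_iff P ε').mp hε'
  have hfd : (val P f.den).d = 1 := (isCoAngularPreStep_iff P f.den).mp f.den_mem
  have hgd : (val P g.den).d = 1 := (isCoAngularPreStep_iff P g.den).mp g.den_mem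
  -- degrees of the numerators agree
  have hdeg : (val P f.num).d = (val P g.num).d := by
    have := congrArg (fun k => (val P k).d) hn
    simp only [comp_d, hε1, hε1', mul_one] at this
    exact this
  -- `μ(den) + μ(ε) = μ(den') + μ(ε')` and `μ(num) + α_d μ(ε) = μ(num') + α_d μ(ε')`
  have hμd : (val P f.den).μ + (val P ε).μ = (val P g.den).μ + (val P ε').μ := by
    rw [← μ_comp_of_d_eq_one P ε f.den hfd, ← μ_comp_of_d_eq_one P ε' g.den hgd, hd]
  have hμn : (val P f.num).μ + P.α (val P f.num).d (val P ε).μ =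
      (val P g.num).μ + P.α (val P g.num).d (val P ε').μ := by
    rw [← μ_comp, ← μ_comp, hn]
  rw [← hdeg] at hμn ⊢
  have e1 : (val P f.den).μ = (val P g.den).μ + (val P ε').μ - (val P ε).μ := by rw [← hμd]; abel
  rw [e1, map_sub, map_add]
  have e2 : (val P f.num).μ = (val P g.num).μ + P.α (val P f.num).d (val P ε').μ - P.α (val P f.num).d (val P ε).μ := by
    rw [← hμn]; abel
  rw [e2]
  abel

/-- **Composition**: the value of a composite computed with any square is `value(g) + α_{d(g)}(value(f))`.
[cite: MochizukiFrdI2008, Ex. 4.6 p.87] -/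
theorem value_compWith (hF : IsFrobenioid (toElem P)) {A : Obj P} (f g : BiratFrac (toElem P) A A)
    (S : BiratFrac.Square f g) :
    (val P (BiratFrac.compWith hF f g S).num).μ -
        P.α (val P (BiratFrac.compWith hF f g S).num).d (val P (BiratFrac.compWith hF f g S).den).μ =
      ((val P g.num).μ - P.α (val P g.num).d (val P g.den).μ) +
        P.α (val P g.num).d ((val P f.num).μ - P.α (val P f.num).d (val P f.den).μ) := by
  have hl : (val P S.left).d = 1 := (isCoAngularPreStep_iff P S.left).mp S.left_mem
  have hfd : (val P f.den).d = 1 := (isCoAngularPreStep_iff P f.den).mp f.den_mem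
  have hgd : (val P g.den).d = 1 := (isCoAngularPreStep_iff P g.den).mp g.den_mem
  have hr : (val P S.right).d = (val P f.num).d := by
    have := congrArg (fun k => (val P k).d) S.w
    simp only [comp_d, hl, hgd, mul_one, one_mul] at this
    exact this.symm
  -- the square at the level of `μ`
  have hsq : (val P f.num).μ + P.α (val P f.num).d (val P S.left).μ = (val P g.den).μ + (val P S.right).μ := by
    rw [← μ_comp, ← μ_comp_of_d_eq_one P S.right g.den hgd, S.w]
  change (val P (S.right ≫ g.num)).μ - P.α (val P (S.right ≫ g.num)).d (val P (S.left ≫ f.den)).μ = _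
  rw [μ_comp, μ_comp_of_d_eq_one P S.left f.den hfd, comp_d, hr, Datum.α_mul, AddMonoidHom.comp_apply]
  have e1 : (val P S.right).μ = (val P f.num).μ + P.α (val P f.num).d (val P S.left).μ - (val P g.den).μ := by
    rw [hsq]; abel
  rw [e1]
  simp only [map_add, map_sub]
  abel

/-! ### `O^▷(A^birat)`: classes of pairs of pre-steps, valued in `M₀` -/

/-- An element of `O^▷(A^birat)` represented by `(α, φ)` has `φ` linear: `d(φ) = 1`.
[cite: MochizukiFrdI2008, Ex. 4.6 p.87] -/
theorem d_num_eq_one_of_mem {hF : IsFrobenioid (toElem P)} {hsq : HasBiratSquares (toElem P)} {A : Obj P}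
    (f : BiratFrac (toElem P) A A)
    (h : (show End ((toBirat (toElem P) hF hsq).obj A) from
        (Birat.homMk (X := (toBirat (toElem P) hF hsq).obj A) (Y := (toBirat (toElem P) hF hsq).obj A) f)) ∈
      endSubmonoid (Birat.toElemGp hF hsq) ((toBirat (toElem P) hF hsq).obj A)) :
    (val P f.num).d = 1 := h.2

/-- Conversely a pair of pre-steps `(α, φ)` defines an element of `O^▷(A^birat)` (base-identity is automatic
over the one-morphism base). [cite: MochizukiFrdI2008, Ex. 4.6 p.87] -/
theorem homMk_mem_endSubmonoid {hF : IsFrobenioid (toElem P)} {hsq : HasBiratSquares (toElem P)} {A : Obj P}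
    (f : BiratFrac (toElem P) A A) (h : (val P f.num).d = 1) :
    (show End ((toBirat (toElem P) hF hsq).obj A) from
        (Birat.homMk (X := (toBirat (toElem P) hF hsq).obj A) (Y := (toBirat (toElem P) hF hsq).obj A) f)) ∈
      endSubmonoid (Birat.toElemGp hF hsq) ((toBirat (toElem P) hF hsq).obj A) :=
  ⟨Subsingleton.elim _ _, h⟩

/-- The value of a pair of pre-steps `(α, φ) : E ⇉ A` is `μ(φ) − μ(α)` and lies in `M₀` (both arrows raise
the index by `a + b = A.idx − E.idx`). [cite: MochizukiFrdI2008, Ex. 4.6 p.87] -/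
theorem value_mem_M₀ {A : Obj P} (f : BiratFrac (toElem P) A A) (h : (val P f.num).d = 1) :
    (val P f.num).μ - (val P f.den).μ ∈ (M₀ : AddSubgroup (Mmod G)) := by
  have hfd : (val P f.den).d = 1 := (isCoAngularPreStep_iff P f.den).mp f.den_mem
  have h1 := idx_eq P f.num
  have h2 := idx_eq P f.den
  rw [h, PNat.one_coe, Nat.cast_one, one_mul] at h1
  rw [hfd, PNat.one_coe, Nat.cast_one, one_mul] at h2
  show ((val P f.num).μ - (val P f.den).μ).2.1 + ((val P f.num).μ - (val P f.den).μ).2.2 = 0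
  simp only [Prod.snd_sub, Prod.fst_sub]
  change (val P f.num).a - (val P f.den).a + ((val P f.num).b - (val P f.den).b) = 0
  linarith

/-- **"`O^×(A^birat) ⊆ M₀`"**: the value of (any representative of) an element of `O^▷(A^birat)` lies in `M₀`.
[cite: MochizukiFrdI2008, Ex. 4.6 p.87] -/
theorem mem_M₀_of_mem_endSubmonoid {hF : IsFrobenioid (toElem P)} {hsq : HasBiratSquares (toElem P)} {A : Obj P}
    (f : BiratFrac (toElem P) A A)
    (h : (show End ((toBirat (toElem P) hF hsq).obj A) from
        (Birat.homMk (X := (toBirat (toElem P) hF hsq).obj A) (Y := (toBirat (toElem P) hF hsq).obj A) f)) ∈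
      endSubmonoid (Birat.toElemGp hF hsq) ((toBirat (toElem P) hF hsq).obj A)) :
    (val P f.num).μ - (val P f.den).μ ∈ (M₀ : AddSubgroup (Mmod G)) :=
  value_mem_M₀ P f (d_num_eq_one_of_mem P f h)

/-- **Injectivity**: two pairs of pre-steps into `A` with the same value `μ(φ) − μ(α)` define the same element
of `Hom^birat(A, A)` (common refinement: shift both sources down by the divisor of the other denominator).
[cite: MochizukiFrdI2008, Ex. 4.6 p.87] -/
theorem homMk_eq_homMk_of_value_eq {hF : IsFrobenioid (toElem P)} {hsq : HasBiratSquares (toElem P)} {A : Obj P}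
    (f g : BiratFrac (toElem P) A A) (hf : (val P f.num).d = 1) (hg : (val P g.num).d = 1)
    (h : (val P f.num).μ - (val P f.den).μ = (val P g.num).μ - (val P g.den).μ) :
    (Birat.homMk (X := (toBirat (toElem P) hF hsq).obj A) (Y := (toBirat (toElem P) hF hsq).obj A) f :
        (toBirat (toElem P) hF hsq).obj A ⟶ (toBirat (toElem P) hF hsq).obj A) =
      Birat.homMk (X := (toBirat (toElem P) hF hsq).obj A) (Y := (toBirat (toElem P) hF hsq).obj A) g := by
  have hfd : (val P f.den).d = 1 := (isCoAngularPreStep_iff P f.den).mp f.den_mem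
  have hgd : (val P g.den).d = 1 := (isCoAngularPreStep_iff P g.den).mp g.den_mem
  have hif := idx_eq P f.den
  have hig := idx_eq P g.den
  rw [hfd, PNat.one_coe, Nat.cast_one, one_mul] at hif
  rw [hgd, PNat.one_coe, Nat.cast_one, one_mul] at hig
  -- common source: index `f.src.idx − (a + b)(g.den)` = `g.src.idx − (a + b)(f.den)`
  let E : Obj P := ⟨f.src.idx - ((val P g.den).a + (val P g.den).b)⟩
  -- `ε = μ(g.den)`-shaped pre-step `E → f.src`, `ε' = μ(f.den)`-shaped pre-step `E → g.src`
  obtain ⟨ε, hε⟩ := exists_hom P E f.src (val P g.den).μ.1 (val P g.den).a (val P g.den).b 1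
    (a_nonneg P _) (b_nonneg P _) (by rw [PNat.one_coe, Nat.cast_one, one_mul]; show f.src.idx - (f.src.idx - _) = _; abel)
  obtain ⟨ε', hε'⟩ := exists_hom P E g.src (val P f.den).μ.1 (val P f.den).a (val P f.den).b 1
    (a_nonneg P _) (b_nonneg P _) (by rw [PNat.one_coe, Nat.cast_one, one_mul]; show g.src.idx - (f.src.idx - _) = _; linarith)
  have hεμ : (val P ε).μ = (val P g.den).μ := by rw [hε]
  have hεμ' : (val P ε').μ = (val P f.den).μ := by rw [hε']
  have H1 : ε ≫ f.den = ε' ≫ g.den := by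
    apply hom_ext P
    refine N.ext ?_ ?_
    · rw [μ_comp_of_d_eq_one P ε f.den hfd, μ_comp_of_d_eq_one P ε' g.den hgd, hεμ, hεμ', add_comm]
    · rw [comp_d, comp_d, hfd, hgd, hε, hε']
  have H2 : ε ≫ f.num = ε' ≫ g.num := by
    apply hom_ext P
    refine N.ext ?_ ?_
    · rw [μ_comp_of_d_eq_one P ε f.num hf, μ_comp_of_d_eq_one P ε' g.num hg, hεμ, hεμ']
      have e1 : (val P f.num).μ = (val P g.num).μ - (val P g.den).μ + (val P f.den).μ := by rw [← h]; abel
      rw [e1]; abel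
    · rw [comp_d, comp_d, hf, hg, hε, hε']
  exact Birat.homMk_sound ⟨E, ε, ε', (isCoAngularPreStep_iff P ε).mpr (by rw [hε]),
    (isCoAngularPreStep_iff P ε').mpr (by rw [hε']), H1, H2⟩

/-- **Surjectivity**: every `m = (g, a, b) ∈ M₀` is the value of a pair of pre-steps into `A`:
`α = (0, t, t, 1)`, `φ = (g, t + a, t + b, 1)` out of `A_{n − 2t}`, `t = |a|`. [cite: MochizukiFrdI2008, Ex. 4.6 p.87] -/
theorem exists_homMk_value_eq (A : Obj P) {m : Mmod G} (hm : m ∈ (M₀ : AddSubgroup (Mmod G))) :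
    ∃ f : BiratFrac (toElem P) A A, (val P f.num).d = 1 ∧ (val P f.num).μ - (val P f.den).μ = m := by
  change m.2.1 + m.2.2 = 0 at hm
  let t : ℤ := |m.2.1|
  have ht : 0 ≤ t := abs_nonneg _
  have hta : 0 ≤ t + m.2.1 := by have := neg_abs_le m.2.1; show 0 ≤ |m.2.1| + m.2.1; linarith
  have htb : 0 ≤ t + m.2.2 := by have := le_abs_self m.2.1; show 0 ≤ |m.2.1| + m.2.2; linarith
  let E : Obj P := ⟨A.idx - (t + t)⟩
  obtain ⟨den, hden⟩ := exists_hom P E A 0 t t 1 ht ht (by rw [PNat.one_coe, Nat.cast_one, one_mul]; show A.idx - (A.idx - _) = _; abel)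
  obtain ⟨num, hnum⟩ := exists_hom P E A m.1 (t + m.2.1) (t + m.2.2) 1 hta htb
    (by rw [PNat.one_coe, Nat.cast_one, one_mul]; show A.idx - (A.idx - _) = _; linarith)
  refine ⟨⟨E, den, num, (isCoAngularPreStep_iff P den).mpr (by rw [hden])⟩, by rw [hnum], ?_⟩
  show (val P num).μ - (val P den).μ = m
  rw [hnum, hden]
  ext <;> simp

/-! ### The isomorphism `O^▷(A^birat) ≅ M₀` -/

/-- **Example 4.6: "`O^×(A^birat) = M₀`"** (FrdI p. 87) — PROVED as a multiplicative bijection: the value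
`[(α, φ)] ↦ μ(φ) − μ(α)` is an isomorphism from `O^▷(A^birat)` (the base-identity linear endomorphisms of
`A^birat` in the birationalization of Prop. 4.4; `= O^×(A^birat)`, `C^birat` being of group-like type) onto
`M₀ = {(g, a, b) : a + b = 0}`. [cite: MochizukiFrdI2008, Ex. 4.6 p.87] -/
theorem exists_endEquivM₀ (hF : IsFrobenioid (toElem P)) (hsq : HasBiratSquares (toElem P)) (A : Obj P) :
    ∃ e : endSubmonoid (Birat.toElemGp hF hsq) ((toBirat (toElem P) hF hsq).obj A) ≃*
        Multiplicative (M₀ : AddSubgroup (Mmod G)),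
      ∀ (f : BiratFrac (toElem P) A A)
        (h : (show End ((toBirat (toElem P) hF hsq).obj A) from
            (Birat.homMk (X := (toBirat (toElem P) hF hsq).obj A) (Y := (toBirat (toElem P) hF hsq).obj A) f)) ∈
          endSubmonoid (Birat.toElemGp hF hsq) ((toBirat (toElem P) hF hsq).obj A)),
        ((Multiplicative.toAdd (e ⟨_, h⟩) : (M₀ : AddSubgroup (Mmod G))) : Mmod G) =
          (val P f.num).μ - (val P f.den).μ := by
  let X : Birat (toElem P) hF hsq := (toBirat (toElem P) hF hsq).obj A
  -- the value on `Hom^birat(A, A)`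
  let v : (X ⟶ X) → Mmod G := fun g =>
    Quotient.lift (s := BiratFrac.setoid (toElem P) hF A A)
      (fun f : BiratFrac (toElem P) A A => (val P f.num).μ - P.α (val P f.num).d (val P f.den).μ)
      (fun _ _ hfg => value_eq_of_rel P hfg) g
  have hv : ∀ f : BiratFrac (toElem P) A A,
      v (Birat.homMk (X := X) (Y := X) f) = (val P f.num).μ - P.α (val P f.num).d (val P f.den).μ := fun _ => rfl
  have hv1 : ∀ f : BiratFrac (toElem P) A A, (val P f.num).d = 1 →
      v (Birat.homMk (X := X) (Y := X) f) = (val P f.num).μ - (val P f.den).μ := fun f hf => by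
    rw [hv, hf, Datum.α_one, AddMonoidHom.id_apply]
  -- representatives of elements of `O^▷(A^birat)`
  have hrep : ∀ u : endSubmonoid (Birat.toElemGp hF hsq) X, ∃ f : BiratFrac (toElem P) A A,
      (val P f.num).d = 1 ∧ (Birat.homMk (X := X) (Y := X) f : X ⟶ X) = u.1 := fun u => by
    obtain ⟨f, hf⟩ := Birat.homMk_surjective (X := X) (Y := X) u.1
    refine ⟨f, ?_, hf⟩
    have hu := u.2
    rw [← hf] at hu
    exact hu.2
  have hvmem : ∀ u : endSubmonoid (Birat.toElemGp hF hsq) X, v u.1 ∈ (M₀ : AddSubgroup (Mmod G)) := fun u => by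
    obtain ⟨f, hf, hfu⟩ := hrep u
    rw [← hfu, hv1 f hf]
    exact value_mem_M₀ P f hf
  have hvmul : ∀ u w : endSubmonoid (Birat.toElemGp hF hsq) X, v (u * w).1 = v u.1 + v w.1 := fun u w => by
    obtain ⟨fu, hfu, hu⟩ := hrep u
    obtain ⟨fw, hfw, hw⟩ := hrep w
    obtain ⟨S⟩ := BiratFrac.nonempty_square hsq fw fu
    have hcomp : (u * w).1 = Birat.homMk (X := X) (Y := X) (BiratFrac.compWith hF fw fu S) := by
      rw [Submonoid.coe_mul, End.mul_def, ← hu, ← hw]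
      exact Birat.homMk_comp_homMk_eq (X := X) (Y := X) (Z := X) fw fu S
    rw [hcomp, hv]
    refine (value_compWith P hF fw fu S).trans ?_
    rw [← hu, ← hw, hv, hv, hfu, Datum.α_one]
    rfl
  -- the inverse: canonical pairs of pre-steps
  have hinv : ∀ m : Multiplicative (M₀ : AddSubgroup (Mmod G)), ∃ f : BiratFrac (toElem P) A A,
      (val P f.num).d = 1 ∧ (val P f.num).μ - (val P f.den).μ =
        ((Multiplicative.toAdd m : (M₀ : AddSubgroup (Mmod G))) : Mmod G) :=
    fun m => exists_homMk_value_eq P A (Multiplicative.toAdd m).2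
  refine ⟨{ toFun := fun u => Multiplicative.ofAdd ⟨v u.1, hvmem u⟩
            invFun := fun m => ⟨Birat.homMk (X := X) (Y := X) (hinv m).choose,
              homMk_mem_endSubmonoid P _ (hinv m).choose_spec.1⟩
            left_inv := fun u => ?_
            right_inv := fun m => ?_
            map_mul' := fun u w => ?_ }, fun f h => ?_⟩
  · obtain ⟨f, hf, hfu⟩ := hrep u
    apply Subtype.ext
    refine (homMk_eq_homMk_of_value_eq P _ f (hinv _).choose_spec.1 hf ?_).trans hfu
    rw [(hinv _).choose_spec.2]
    have e1 : v (Birat.homMk (X := X) (Y := X) f) = v u.1 := congrArg v hfu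
    exact (e1.symm.trans (hv1 f hf) : v u.1 = _)
  · apply Multiplicative.toAdd.injective
    apply Subtype.ext
    show v (Birat.homMk (X := X) (Y := X) (hinv m).choose) = ((Multiplicative.toAdd m : (M₀ : AddSubgroup (Mmod G))) : Mmod G)
    rw [hv1 _ (hinv m).choose_spec.1, (hinv m).choose_spec.2]
  · apply Multiplicative.toAdd.injective
    apply Subtype.ext
    show v (u * w).1 = v u.1 + v w.1
    exact hvmul u w
  · show v (Birat.homMk (X := X) (Y := X) f) = _
    exact hv1 f h.2

/-! ### The `N_{≥1}`-action on `O^×(A₀^birat) = M₀` through the Frobenius endomorphisms `(0,0,0,d)` -/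

/-- In a composition square the right leg has the degree of the first numerator. [cite: MochizukiFrdI2008, Ex. 4.6 p.87] -/
theorem d_right_eq {A : Obj P} {f g : BiratFrac (toElem P) A A} (S : BiratFrac.Square f g) :
    (val P S.right).d = (val P f.num).d := by
  have hl : (val P S.left).d = 1 := (isCoAngularPreStep_iff P S.left).mp S.left_mem
  have hgd : (val P g.den).d = 1 := (isCoAngularPreStep_iff P g.den).mp g.den_mem
  have := congrArg (fun k => (val P k).d) S.w
  simp only [comp_d, hl, hgd, mul_one, one_mul] at this
  exact this.symm

/-- **Injectivity in every degree**: two fractions `(α, φ)`, `(α', φ')` into `A` with `d(φ) = d(φ')` and the same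
value `μ(φ) − α_d(μ(α))` define the same birational endomorphism. [cite: MochizukiFrdI2008, Ex. 4.6 p.87] -/
theorem homMk_eq_homMk_of_value_eq' {hF : IsFrobenioid (toElem P)} {hsq : HasBiratSquares (toElem P)} {A : Obj P}
    (f g : BiratFrac (toElem P) A A) (hfg : (val P f.num).d = (val P g.num).d)
    (h : (val P f.num).μ - P.α (val P f.num).d (val P f.den).μ = (val P g.num).μ - P.α (val P g.num).d (val P g.den).μ) :
    (Birat.homMk (X := (toBirat (toElem P) hF hsq).obj A) (Y := (toBirat (toElem P) hF hsq).obj A) f :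
        (toBirat (toElem P) hF hsq).obj A ⟶ (toBirat (toElem P) hF hsq).obj A) =
      Birat.homMk (X := (toBirat (toElem P) hF hsq).obj A) (Y := (toBirat (toElem P) hF hsq).obj A) g := by
  have hfd : (val P f.den).d = 1 := (isCoAngularPreStep_iff P f.den).mp f.den_mem
  have hgd : (val P g.den).d = 1 := (isCoAngularPreStep_iff P g.den).mp g.den_mem
  have hif := idx_eq P f.den
  have hig := idx_eq P g.den
  rw [hfd, PNat.one_coe, Nat.cast_one, one_mul] at hif
  rw [hgd, PNat.one_coe, Nat.cast_one, one_mul] at hig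
  let E : Obj P := ⟨f.src.idx - ((val P g.den).a + (val P g.den).b)⟩
  obtain ⟨ε, hε⟩ := exists_hom P E f.src (val P g.den).μ.1 (val P g.den).a (val P g.den).b 1
    (a_nonneg P _) (b_nonneg P _) (by rw [PNat.one_coe, Nat.cast_one, one_mul]; show f.src.idx - (f.src.idx - _) = _; abel)
  obtain ⟨ε', hε'⟩ := exists_hom P E g.src (val P f.den).μ.1 (val P f.den).a (val P f.den).b 1
    (a_nonneg P _) (b_nonneg P _) (by rw [PNat.one_coe, Nat.cast_one, one_mul]; show g.src.idx - (f.src.idx - _) = _; linarith)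
  have hεμ : (val P ε).μ = (val P g.den).μ := by rw [hε]
  have hεμ' : (val P ε').μ = (val P f.den).μ := by rw [hε']
  have H1 : ε ≫ f.den = ε' ≫ g.den := by
    apply hom_ext P
    refine N.ext ?_ ?_
    · rw [μ_comp_of_d_eq_one P ε f.den hfd, μ_comp_of_d_eq_one P ε' g.den hgd, hεμ, hεμ', add_comm]
    · rw [comp_d, comp_d, hfd, hgd, hε, hε']
  have H2 : ε ≫ f.num = ε' ≫ g.num := by
    apply hom_ext P
    refine N.ext ?_ ?_
    · rw [μ_comp, μ_comp, hεμ, hεμ', ← hfg]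
      have e1 : (val P f.num).μ = (val P g.num).μ - P.α (val P f.num).d (val P g.den).μ +
          P.α (val P f.num).d (val P f.den).μ := by
        rw [hfg] at h ⊢; rw [← h]; abel
      rw [e1]; abel
    · rw [comp_d, comp_d, hfg, hε, hε']
  exact Birat.homMk_sound ⟨E, ε, ε', (isCoAngularPreStep_iff P ε).mpr (by rw [hε]),
    (isCoAngularPreStep_iff P ε').mpr (by rw [hε']), H1, H2⟩

/-- **Example 4.6: "the morphisms `(0, 0, 0, d) ∈ N` determine … an action of `N_{≥1}` on `O^×(A₀^birat) = M₀`,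
which is easily verified to coincide with the restriction to `M₀` of the original action of `N_{≥1}` on `M`"**
(FrdI p. 87) — PROVED in the form: for `ζ = (0,0,0,n) ∈ End(A₀)` and a unit `u = [(α, φ)] ∈ O^▷(A₀^birat)` of value
`m`, one has `u ≫ ζ = ζ ≫ u'` in `C^birat` for a unit `u'` of value `α_n(m)`. [cite: MochizukiFrdI2008, Ex. 4.6 p.87] -/
theorem frobenius_transport_value (hF : IsFrobenioid (toElem P)) (hsq : HasBiratSquares (toElem P)) {n : ℕ+}
    (ζ : A₀ P ⟶ A₀ P) (hζ : val P ζ = ⟨0, n⟩) (f : BiratFrac (toElem P) (A₀ P) (A₀ P)) (hf : (val P f.num).d = 1) :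
    ∃ g : BiratFrac (toElem P) (A₀ P) (A₀ P), (val P g.num).d = 1 ∧
      (val P g.num).μ - (val P g.den).μ = P.α n ((val P f.num).μ - (val P f.den).μ) ∧
      (Birat.homMk (X := (toBirat (toElem P) hF hsq).obj (A₀ P)) (Y := (toBirat (toElem P) hF hsq).obj (A₀ P)) f ≫
          (toBirat (toElem P) hF hsq).map ζ :
          (toBirat (toElem P) hF hsq).obj (A₀ P) ⟶ (toBirat (toElem P) hF hsq).obj (A₀ P)) =
        (toBirat (toElem P) hF hsq).map ζ ≫
          Birat.homMk (X := (toBirat (toElem P) hF hsq).obj (A₀ P)) (Y := (toBirat (toElem P) hF hsq).obj (A₀ P)) g := by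
  -- the transported unit: value `α_n(m) ∈ M₀`
  obtain ⟨g, hg, hgv⟩ := exists_homMk_value_eq P (A₀ P)
    (α_mem_M₀ P n (value_mem_M₀ P f hf))
  refine ⟨g, hg, hgv, ?_⟩
  -- both composites, computed with squares, have degree `n` and value `α_n(m)`
  obtain ⟨S₁⟩ := BiratFrac.nonempty_square hsq f (BiratFrac.ofHom hF ζ)
  obtain ⟨S₂⟩ := BiratFrac.nonempty_square hsq (BiratFrac.ofHom hF ζ) g
  rw [toBirat_map]
  have lhs := Birat.homMk_comp_homMk_eq (X := (toBirat (toElem P) hF hsq).obj (A₀ P))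
      (Y := (toBirat (toElem P) hF hsq).obj (A₀ P)) (Z := (toBirat (toElem P) hF hsq).obj (A₀ P)) f _ S₁
  have rhs := Birat.homMk_comp_homMk_eq (X := (toBirat (toElem P) hF hsq).obj (A₀ P))
      (Y := (toBirat (toElem P) hF hsq).obj (A₀ P)) (Z := (toBirat (toElem P) hF hsq).obj (A₀ P)) _ g S₂
  refine lhs.trans (Eq.trans ?_ rhs.symm)
  have hζd : (val P (BiratFrac.ofHom hF ζ).num).d = n := by show (val P ζ).d = n; rw [hζ]
  have hζv : (val P (BiratFrac.ofHom hF ζ).num).μ - P.α (val P (BiratFrac.ofHom hF ζ).num).d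
      (val P (BiratFrac.ofHom hF ζ).den).μ = 0 := by
    show (val P ζ).μ - P.α (val P ζ).d (val P (𝟙 (A₀ P))).μ = 0
    rw [hζ, val_id, N.one_μ, map_zero, sub_zero]
  refine homMk_eq_homMk_of_value_eq' P _ _ ?_ ?_
  · show (val P (S₁.right ≫ (BiratFrac.ofHom hF ζ).num)).d = (val P (S₂.right ≫ g.num)).d
    rw [comp_d, comp_d, d_right_eq P S₁, d_right_eq P S₂, hζd, hf, hg, mul_one, one_mul]
  · refine (value_compWith P hF f _ S₁).trans (Eq.trans ?_ (value_compWith P hF _ g S₂).symm)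
    rw [hζv, hζd, hf, hg, map_zero, add_zero, zero_add, Datum.α_one, AddMonoidHom.id_apply,
      AddMonoidHom.id_apply, hgv]

end Ex46

end Literature.AlgebraicGeometry.Frobenioids
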